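import Summits.Ventures.YMGap.Thresholds.OneLinkCasimirTwo
import Summits.Ventures.YMGap.Thresholds.OneLinkPoissonCovariance
import HarnessLib

/-!
# Venture YMGap — the one-link modulus beyond first order, part 5: the Schwinger–Dyson identities for the MEANS of the
# quadratic trace polynomials under the one-link measure `ν_B`

HONEST FRAMING: venture file of the cell `pub-ymgap` (QuantumFields programme), strong-coupling LATTICE bookkeeping for `SU(N)`
lattice Yang–Mills; nothing about the continuum or the mass gap in the Clay sense.  Exact integral identities only (no number of
record): the first analytic ingredient («F4», part 1, of the cell note `HOME/p2/ONE-LINK-HIERARCHY.md` §4 (4.3)–(4.4)) — the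
means `E_ν Re tr(gM₁gM₂)`, `E_ν Re(tr(gM₁)tr(gM₂))`, `E_ν Re(tr(gM₁) conj tr(gM₂))` expressed EXACTLY through the means of the cubic
carré-du-champ terms `Γ(Re tr(·B), ·)` (whose closed forms are `OneLinkFeedback`), by integration by parts against the generator
(`∫ L_S f dν_B = 0`) and the degree-2 Casimir algebra (`OneLinkCasimirTwo`).

WHAT.  `ν_B(dg) ∝ exp(N Re tr(gB)) dg` on `SU(N)`; `Gw := ∫ Γ(Re tr(·B), Re tr(QM₁QM₂)) dν`, `Gt`, `Gs` likewise; `a := 2N − 4/N`.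
* `integral_Lap_eq_neg` : `∫ Δ f dν = −N ∫ Γ(Re tr(·B), f) dν` (smooth `f`).
* `integral_reTrQuad_eq`, `integral_reTrProd_eq` (`N ≥ 3`):  `E Re tr(gM₁gM₂) = N(a·Gw − 2·Gt)/(a² − 4)`,
  `E Re(tr(gM₁)tr(gM₂)) = N(a·Gt − 2·Gw)/(a² − 4)`   (`a² − 4 = λ₊λ₋`, the product of the `Sym²`/`Λ²` Casimirs).
* `integral_reTrProdConj_eq` (`N ≥ 1`):  `E Re(tr(gM₁) conj tr(gM₂)) = Re tr(M₁M₂ᴴ)/N + Gs/2`   (Haar value + correction).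
Consequences (next files): with the pointwise/`L²(ν)` bounds on the cubic terms these give the primitives `μ₂`, `ω` and the
second-order mean-link constant `m₁` of the cell note, all `N`-uniform.

References: cell notes `HOME/p2/ONE-LINK-HIERARCHY.md` §4; Bröcker–tom Dieck GTM 98 II.5; Shen–Zhu–Zhu CMP 400 (2023) §4.1.
-/

noncomputable section

open scoped Matrix ComplexConjugate BigOperators ContDiff Matrix.Norms.Frobenius
open Matrix Complex Finset MeasureTheory ProbabilityTheory
open Literature.MathematicalPhysics.QuantumFieldTheory
open Literature.MathematicalPhysics.QuantumFieldTheory.SUNBakryEmery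

namespace Summit.Ventures.YMGap.OneLinkEigen

variable {N : ℕ}

/-- **`∫ Δf dν_B = −N ∫ Γ(Re tr(·B), f) dν_B`** for smooth `f` — integration by parts against the generator
`L_S = Δ + N Γ(Re tr(·B), ·)`, `∫ L_S f dν_B = 0`. [folklore] -/
theorem integral_Lap_eq_neg (hN : N ≠ 0) (B : Matrix (Fin N) (Fin N) ℂ) {f : Matrix (Fin N) (Fin N) ℂ → ℝ}
    (hf : ContDiff ℝ ∞ f) :
    ∫ g, Lap f g ∂(haarProbability (SUN N)).tilted (fun g => (N : ℝ) * ((g : Matrix (Fin N) (Fin N) ℂ) * B).trace.re) =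
      -((N : ℝ) * ∫ g, Gam (pot 1 B) f g
        ∂(haarProbability (SUN N)).tilted (fun g => (N : ℝ) * ((g : Matrix (Fin N) (Fin N) ℂ) * B).trace.re)) := by
  set S : Matrix (Fin N) (Fin N) ℂ → ℝ := pot (N : ℝ) B with hSdef
  have hS : ContDiff ℝ ∞ S := contDiff_pot _ B
  set ν : Measure (SUN N) :=
    (haarProbability (SUN N)).tilted (fun g => (N : ℝ) * ((g : Matrix (Fin N) (Fin N) ℂ) * B).trace.re) with hν
  have hexpc : Continuous fun g : SUN N => Real.exp (S g) := Real.continuous_exp.comp (continuous_restrict hS)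
  have hexpi : Integrable (fun g : SUN N => Real.exp ((N : ℝ) * ((g : Matrix (Fin N) (Fin N) ℂ) * B).trace.re))
      (haarProbability (SUN N)) := integrable_of_continuous_SUN hexpc _
  haveI : IsProbabilityMeasure ν := isProbabilityMeasure_tilted hexpi
  have htilt : ∀ f : SUN N → ℝ, ∫ g, f g ∂ν = (∫ g : SUN N, Real.exp (S g) * f g ∂(haarSU N)) /
      ∫ g : SUN N, Real.exp (S g) ∂(haarSU N) := fun f => by rw [hν]; exact integral_tilted_eq_div _ f
  have h0 : ∫ g, genL S f g ∂ν = 0 := by rw [htilt, integral_exp_mul_genL_eq_zero hN hS hf, zero_div]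
  have hsplit : (fun g : SUN N => genL S f g) = fun g : SUN N => Lap f g + (N : ℝ) * Gam (pot 1 B) f g := by
    funext g
    show Lap f g + Gam S f g = _
    rw [hSdef, Gam_pot_left_smul (N : ℝ) B f]
  have i1 : Integrable (fun g : SUN N => Lap f g) ν := integrable_of_continuous_SUN (continuous_restrict (contDiff_Lap hf)) ν
  have i2 : Integrable (fun g : SUN N => (N : ℝ) * Gam (pot 1 B) f g) ν :=
    (integrable_of_continuous_SUN (continuous_restrict (contDiff_Gam (contDiff_pot 1 B) hf)) ν).const_mul _
  rw [hsplit, integral_add i1 i2, integral_const_mul] at h0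
  linarith

/-- **Schwinger–Dyson for the quadratic word and the product (`N ≥ 3`)**: with `a = 2N − 4/N`,
`Gw = ∫ Γ(Re tr(·B), Re tr(QM₁QM₂)) dν_B`, `Gt = ∫ Γ(Re tr(·B), Re(tr(QM₁)tr(QM₂))) dν_B`:
`(a² − 4) · E_ν Re tr(gM₁gM₂) = N (a·Gw − 2·Gt)`. [folklore] -/
theorem integral_reTrQuad_eq (hN : 3 ≤ N) (B M₁ M₂ : Matrix (Fin N) (Fin N) ℂ) :
    ((2 * (N : ℝ) - 4 / N) ^ 2 - 4) *
        ∫ g, ((g : Matrix (Fin N) (Fin N) ℂ) * M₁ * g * M₂).trace.re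
          ∂(haarProbability (SUN N)).tilted (fun g => (N : ℝ) * ((g : Matrix (Fin N) (Fin N) ℂ) * B).trace.re) =
      (N : ℝ) * ((2 * (N : ℝ) - 4 / N) *
          ∫ g, Gam (pot 1 B) (fun Q : Matrix (Fin N) (Fin N) ℂ => (Q * M₁ * Q * M₂).trace.re) g
            ∂(haarProbability (SUN N)).tilted (fun g => (N : ℝ) * ((g : Matrix (Fin N) (Fin N) ℂ) * B).trace.re)
        - 2 * ∫ g, Gam (pot 1 B) (fun Q : Matrix (Fin N) (Fin N) ℂ => ((Q * M₁).trace * (Q * M₂).trace).re) g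
            ∂(haarProbability (SUN N)).tilted (fun g => (N : ℝ) * ((g : Matrix (Fin N) (Fin N) ℂ) * B).trace.re)) := by
  have hN0 : N ≠ 0 := by omega
  set ν : Measure (SUN N) :=
    (haarProbability (SUN N)).tilted (fun g => (N : ℝ) * ((g : Matrix (Fin N) (Fin N) ℂ) * B).trace.re) with hν
  have hexpi : Integrable (fun g : SUN N => Real.exp ((N : ℝ) * ((g : Matrix (Fin N) (Fin N) ℂ) * B).trace.re))
      (haarProbability (SUN N)) :=
    integrable_of_continuous_SUN (Real.continuous_exp.comp (continuous_restrict (contDiff_pot (N : ℝ) B))) _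
  haveI : IsProbabilityMeasure ν := isProbabilityMeasure_tilted hexpi
  have hw := integral_Lap_eq_neg hN0 B (contDiff_reTrQuad M₁ M₂) (N := N)
  have ht := integral_Lap_eq_neg hN0 B (contDiff_reTrProd M₁ M₂) (N := N)
  rw [Lap_reTrQuad hN0, ← hν] at hw
  rw [Lap_reTrProd hN0, ← hν] at ht
  have iw : Integrable (fun g : SUN N => ((g : Matrix (Fin N) (Fin N) ℂ) * M₁ * g * M₂).trace.re) ν :=
    integrable_of_continuous_SUN (continuous_restrict (contDiff_reTrQuad M₁ M₂)) ν
  have it : Integrable (fun g : SUN N => (((g : Matrix (Fin N) (Fin N) ℂ) * M₁).trace * ((g : Matrix (Fin N) (Fin N) ℂ) * M₂).trace).re) ν :=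
    integrable_of_continuous_SUN (continuous_restrict (contDiff_reTrProd M₁ M₂)) ν
  have e1 : ∫ g, (-((2 * (N : ℝ) - 4 / N) * ((g : Matrix (Fin N) (Fin N) ℂ) * M₁ * g * M₂).trace.re)
      - 2 * (((g : Matrix (Fin N) (Fin N) ℂ) * M₁).trace * ((g : Matrix (Fin N) (Fin N) ℂ) * M₂).trace).re) ∂ν =
      -((2 * (N : ℝ) - 4 / N) * ∫ g, ((g : Matrix (Fin N) (Fin N) ℂ) * M₁ * g * M₂).trace.re ∂ν)
        - 2 * ∫ g, (((g : Matrix (Fin N) (Fin N) ℂ) * M₁).trace * ((g : Matrix (Fin N) (Fin N) ℂ) * M₂).trace).re ∂ν := by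
    have i1 : Integrable (fun g : SUN N => -((2 * (N : ℝ) - 4 / N) * ((g : Matrix (Fin N) (Fin N) ℂ) * M₁ * g * M₂).trace.re)) ν :=
      (iw.const_mul _).neg
    rw [integral_sub i1 (it.const_mul _), integral_neg, integral_const_mul, integral_const_mul]
  have e2 : ∫ g, (-((2 * (N : ℝ) - 4 / N) * (((g : Matrix (Fin N) (Fin N) ℂ) * M₁).trace * ((g : Matrix (Fin N) (Fin N) ℂ) * M₂).trace).re)
      - 2 * ((g : Matrix (Fin N) (Fin N) ℂ) * M₁ * g * M₂).trace.re) ∂ν =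
      -((2 * (N : ℝ) - 4 / N) * ∫ g, (((g : Matrix (Fin N) (Fin N) ℂ) * M₁).trace * ((g : Matrix (Fin N) (Fin N) ℂ) * M₂).trace).re ∂ν)
        - 2 * ∫ g, ((g : Matrix (Fin N) (Fin N) ℂ) * M₁ * g * M₂).trace.re ∂ν := by
    have i1 : Integrable (fun g : SUN N => -((2 * (N : ℝ) - 4 / N) *
        (((g : Matrix (Fin N) (Fin N) ℂ) * M₁).trace * ((g : Matrix (Fin N) (Fin N) ℂ) * M₂).trace).re)) ν :=
      (it.const_mul _).neg
    rw [integral_sub i1 (iw.const_mul _), integral_neg, integral_const_mul, integral_const_mul]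
  rw [e1] at hw
  rw [e2] at ht
  linear_combination (-(2 * (N : ℝ) - 4 / N)) * hw + 2 * ht

/-- **Schwinger–Dyson for the product (`N ≥ 3`)**: `(a² − 4) · E_ν Re(tr(gM₁)tr(gM₂)) = N (a·Gt − 2·Gw)`, `a = 2N − 4/N`. [folklore] -/
theorem integral_reTrProd_eq (hN : 3 ≤ N) (B M₁ M₂ : Matrix (Fin N) (Fin N) ℂ) :
    ((2 * (N : ℝ) - 4 / N) ^ 2 - 4) *
        ∫ g, (((g : Matrix (Fin N) (Fin N) ℂ) * M₁).trace * ((g : Matrix (Fin N) (Fin N) ℂ) * M₂).trace).re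
          ∂(haarProbability (SUN N)).tilted (fun g => (N : ℝ) * ((g : Matrix (Fin N) (Fin N) ℂ) * B).trace.re) =
      (N : ℝ) * ((2 * (N : ℝ) - 4 / N) *
          ∫ g, Gam (pot 1 B) (fun Q : Matrix (Fin N) (Fin N) ℂ => ((Q * M₁).trace * (Q * M₂).trace).re) g
            ∂(haarProbability (SUN N)).tilted (fun g => (N : ℝ) * ((g : Matrix (Fin N) (Fin N) ℂ) * B).trace.re)
        - 2 * ∫ g, Gam (pot 1 B) (fun Q : Matrix (Fin N) (Fin N) ℂ => (Q * M₁ * Q * M₂).trace.re) g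
            ∂(haarProbability (SUN N)).tilted (fun g => (N : ℝ) * ((g : Matrix (Fin N) (Fin N) ℂ) * B).trace.re)) := by
  have hN0 : N ≠ 0 := by omega
  set ν : Measure (SUN N) :=
    (haarProbability (SUN N)).tilted (fun g => (N : ℝ) * ((g : Matrix (Fin N) (Fin N) ℂ) * B).trace.re) with hν
  have hexpi : Integrable (fun g : SUN N => Real.exp ((N : ℝ) * ((g : Matrix (Fin N) (Fin N) ℂ) * B).trace.re))
      (haarProbability (SUN N)) :=
    integrable_of_continuous_SUN (Real.continuous_exp.comp (continuous_restrict (contDiff_pot (N : ℝ) B))) _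
  haveI : IsProbabilityMeasure ν := isProbabilityMeasure_tilted hexpi
  have hw := integral_Lap_eq_neg hN0 B (contDiff_reTrQuad M₁ M₂) (N := N)
  have ht := integral_Lap_eq_neg hN0 B (contDiff_reTrProd M₁ M₂) (N := N)
  rw [Lap_reTrQuad hN0, ← hν] at hw
  rw [Lap_reTrProd hN0, ← hν] at ht
  have iw : Integrable (fun g : SUN N => ((g : Matrix (Fin N) (Fin N) ℂ) * M₁ * g * M₂).trace.re) ν :=
    integrable_of_continuous_SUN (continuous_restrict (contDiff_reTrQuad M₁ M₂)) ν
  have it : Integrable (fun g : SUN N => (((g : Matrix (Fin N) (Fin N) ℂ) * M₁).trace * ((g : Matrix (Fin N) (Fin N) ℂ) * M₂).trace).re) ν :=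
    integrable_of_continuous_SUN (continuous_restrict (contDiff_reTrProd M₁ M₂)) ν
  have e1 : ∫ g, (-((2 * (N : ℝ) - 4 / N) * ((g : Matrix (Fin N) (Fin N) ℂ) * M₁ * g * M₂).trace.re)
      - 2 * (((g : Matrix (Fin N) (Fin N) ℂ) * M₁).trace * ((g : Matrix (Fin N) (Fin N) ℂ) * M₂).trace).re) ∂ν =
      -((2 * (N : ℝ) - 4 / N) * ∫ g, ((g : Matrix (Fin N) (Fin N) ℂ) * M₁ * g * M₂).trace.re ∂ν)
        - 2 * ∫ g, (((g : Matrix (Fin N) (Fin N) ℂ) * M₁).trace * ((g : Matrix (Fin N) (Fin N) ℂ) * M₂).trace).re ∂ν := by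
    have i1 : Integrable (fun g : SUN N => -((2 * (N : ℝ) - 4 / N) * ((g : Matrix (Fin N) (Fin N) ℂ) * M₁ * g * M₂).trace.re)) ν :=
      (iw.const_mul _).neg
    rw [integral_sub i1 (it.const_mul _), integral_neg, integral_const_mul, integral_const_mul]
  have e2 : ∫ g, (-((2 * (N : ℝ) - 4 / N) * (((g : Matrix (Fin N) (Fin N) ℂ) * M₁).trace * ((g : Matrix (Fin N) (Fin N) ℂ) * M₂).trace).re)
      - 2 * ((g : Matrix (Fin N) (Fin N) ℂ) * M₁ * g * M₂).trace.re) ∂ν =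
      -((2 * (N : ℝ) - 4 / N) * ∫ g, (((g : Matrix (Fin N) (Fin N) ℂ) * M₁).trace * ((g : Matrix (Fin N) (Fin N) ℂ) * M₂).trace).re ∂ν)
        - 2 * ∫ g, ((g : Matrix (Fin N) (Fin N) ℂ) * M₁ * g * M₂).trace.re ∂ν := by
    have i1 : Integrable (fun g : SUN N => -((2 * (N : ℝ) - 4 / N) *
        (((g : Matrix (Fin N) (Fin N) ℂ) * M₁).trace * ((g : Matrix (Fin N) (Fin N) ℂ) * M₂).trace).re)) ν :=
      (it.const_mul _).neg
    rw [integral_sub i1 (iw.const_mul _), integral_neg, integral_const_mul, integral_const_mul]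
  rw [e1] at hw
  rw [e2] at ht
  linear_combination 2 * hw + (-(2 * (N : ℝ) - 4 / N)) * ht

/-- **Schwinger–Dyson for the mixed product**: `E_ν Re(tr(gM₁) conj tr(gM₂)) = Re tr(M₁M₂ᴴ)/N + ½ ∫ Γ(Re tr(·B), Re s) dν_B` — the
Haar value plus the tilt correction (adjoint Casimir `2N`). [folklore] -/
theorem integral_reTrProdConj_eq (hN : N ≠ 0) (B M₁ M₂ : Matrix (Fin N) (Fin N) ℂ) :
    ∫ g, (((g : Matrix (Fin N) (Fin N) ℂ) * M₁).trace * (starRingEnd ℂ) ((g : Matrix (Fin N) (Fin N) ℂ) * M₂).trace).re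
        ∂(haarProbability (SUN N)).tilted (fun g => (N : ℝ) * ((g : Matrix (Fin N) (Fin N) ℂ) * B).trace.re) =
      (M₁ * M₂ᴴ).trace.re / N + (1 / 2) *
        ∫ g, Gam (pot 1 B) (fun Q : Matrix (Fin N) (Fin N) ℂ => ((Q * M₁).trace * (starRingEnd ℂ) (Q * M₂).trace).re) g
          ∂(haarProbability (SUN N)).tilted (fun g => (N : ℝ) * ((g : Matrix (Fin N) (Fin N) ℂ) * B).trace.re) := by
  have hNr : (N : ℝ) ≠ 0 := by exact_mod_cast hN
  set ν : Measure (SUN N) :=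
    (haarProbability (SUN N)).tilted (fun g => (N : ℝ) * ((g : Matrix (Fin N) (Fin N) ℂ) * B).trace.re) with hν
  have hexpi : Integrable (fun g : SUN N => Real.exp ((N : ℝ) * ((g : Matrix (Fin N) (Fin N) ℂ) * B).trace.re))
      (haarProbability (SUN N)) :=
    integrable_of_continuous_SUN (Real.continuous_exp.comp (continuous_restrict (contDiff_pot (N : ℝ) B))) _
  haveI : IsProbabilityMeasure ν := isProbabilityMeasure_tilted hexpi
  have hs := integral_Lap_eq_neg hN B (contDiff_reTrProdConj M₁ M₂) (N := N)
  rw [Lap_reTrProdConj hN, ← hν] at hs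
  have is : Integrable (fun g : SUN N =>
      (((g : Matrix (Fin N) (Fin N) ℂ) * M₁).trace * (starRingEnd ℂ) ((g : Matrix (Fin N) (Fin N) ℂ) * M₂).trace).re) ν :=
    integrable_of_continuous_SUN (continuous_restrict (contDiff_reTrProdConj M₁ M₂)) ν
  have hconst : ∀ g : SUN N, (M₁ * (g : Matrix (Fin N) (Fin N) ℂ) * (M₂ * (g : Matrix (Fin N) (Fin N) ℂ))ᴴ).trace.re =
      (M₁ * M₂ᴴ).trace.re := fun g => by rw [mul_su_mul_conjTranspose]
  have e1 : ∫ g, (-(2 * (N : ℝ) * (((g : Matrix (Fin N) (Fin N) ℂ) * M₁).trace *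
        (starRingEnd ℂ) ((g : Matrix (Fin N) (Fin N) ℂ) * M₂).trace).re)
      + 2 * (M₁ * (g : Matrix (Fin N) (Fin N) ℂ) * (M₂ * (g : Matrix (Fin N) (Fin N) ℂ))ᴴ).trace.re) ∂ν =
      -(2 * (N : ℝ) * ∫ g, (((g : Matrix (Fin N) (Fin N) ℂ) * M₁).trace *
          (starRingEnd ℂ) ((g : Matrix (Fin N) (Fin N) ℂ) * M₂).trace).re ∂ν) + 2 * (M₁ * M₂ᴴ).trace.re := by
    simp_rw [hconst]
    have i1 : Integrable (fun g : SUN N => -(2 * (N : ℝ) * (((g : Matrix (Fin N) (Fin N) ℂ) * M₁).trace *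
        (starRingEnd ℂ) ((g : Matrix (Fin N) (Fin N) ℂ) * M₂).trace).re)) ν := (is.const_mul _).neg
    rw [integral_add i1 (integrable_const _), integral_neg, integral_const_mul, integral_const]
    simp
  rw [e1] at hs
  field_simp
  linarith

/-- **Schwinger–Dyson for the linear statistic** (the identity behind the tree's `abs_mean_linear_le`):
`(N − 1/N) · E_ν Re tr(gM) = N · ∫ Γ(Re tr(·B), Re tr(·M)) dν_B`. [folklore] -/
theorem integral_pot_eq (hN : N ≠ 0) (B M : Matrix (Fin N) (Fin N) ℂ) :
    ((N : ℝ) - 1 / N) * ∫ g, ((g : Matrix (Fin N) (Fin N) ℂ) * M).trace.re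
        ∂(haarProbability (SUN N)).tilted (fun g => (N : ℝ) * ((g : Matrix (Fin N) (Fin N) ℂ) * B).trace.re) =
      (N : ℝ) * ∫ g, Gam (pot 1 B) (pot 1 M) g
        ∂(haarProbability (SUN N)).tilted (fun g => (N : ℝ) * ((g : Matrix (Fin N) (Fin N) ℂ) * B).trace.re) := by
  have h := integral_Lap_eq_neg hN B (contDiff_pot 1 M) (N := N)
  rw [Lap_pot hN 1 M] at h
  have e : (fun g : SUN N => -(((N : ℝ) - 1 / N) * pot 1 M (g : Matrix (Fin N) (Fin N) ℂ))) =
      fun g : SUN N => -((N : ℝ) - 1 / N) * ((g : Matrix (Fin N) (Fin N) ℂ) * M).trace.re := by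
    funext g; simp only [pot, one_mul]; ring
  rw [e, integral_const_mul] at h
  linarith

end Summit.Ventures.YMGap.OneLinkEigen
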